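/-
Copyright (c) 2026 the pub-hodgecm-mathlib formalisation cell (harness21).  Prover seat hodgecm-mathlib-K2E2-p03 (g0),
Track B «K2-LIT» ∕ h413 (stmt-HodgeConjecture-24833), line K2_E2 «ThetaExhaustionByRigidity», unit ADM-REP, file #3:
payment of the socket `K2E2ThetaExhaustionByRigidity.AdmRep.sig_K2E2AdmUnitOfAdmissibleElement` — FROM AN ADMISSIBLE ELEMENT
TO AN ADMISSIBLE UNIT REPRESENTATIVE OF THE SAME COLLECTION.  2026-09-03.  KERNEL module: THEOREMS ONLY (no definition,
no named fact, no `sorry`, no instance, no notation).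
-/
import Summits.HodgeConjecture.HodgeConjecture.Theorems.F0P2sThetaOccursInLineTransport   -- ★ `exists_admissibleUnit_of_hadm`
import HarnessLib

/-!
# K2_E2 road (h413 = stmt-HodgeConjecture-24833), unit ADM-REP, file #3:
# the admissible unit representative `a′ = e · 2δ_L` of the collection `locF a`

Cell `pub/hodgecm-mathlib` (D-0151), Track B (21-frontier RULING «PUSH BOTH» 2026-09-03, director req621∕req624, chair K2-lead,
dealer K2E2-plan), socket module
`Summits/HodgeConjecture/HodgeConjecture/Cruxes/H413/Lines/K2_E2_ThetaExhaustionByRigidity_AdmRep.lean` (planner K2E2-plan (g0),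
sha16 0ce0c102f00b9ca4), socket **`sig_K2E2AdmUnitOfAdmissibleElement`** (SIGS TABLE row #3, size S): for a CM field `L` with maximal
real subfield `L⁺`, a set of embeddings `Φ ⊆ Hom(L, ℂ)` (for the line: the CM type `Φ_μ`) and a line `a ∈ (L⁺)ˣ`, IF some `e ∈ L` is
`Φ`-admissible ([Liu2021, Def. 4.12]: `e ≠ 0`, `ē = −e`, `Im τ′(e) < 0` for all `τ′ ∈ Φ`) with collection
`epsOf (2δ_L)⁻¹ e = locF a` (`δ_L = imagUnit L`, ★ `UnitaryDualPair.imagUnit`), THEN there is a unit `a′ ∈ (L⁺)ˣ` with the same collection,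
`locF a′ = locF a`, such that `a′ · (2δ_L)⁻¹` is `Φ`-admissible.

THE MATHEMATICS (one rewrite on top of the tree).
* ★ `F0P2sThetaOccursInLineTransport.exists_admissibleUnit_of_hadm` ([Liu2021, Def. 4.12]; ★ `AdmissibleLine.epsOf_eq_locF_mk0`) already
  produces, from the same hypothesis, an admissible `e` and a unit `a′ ∈ (L⁺)ˣ` with `(a′ : L) = e · (2 · imagUnit L)` and `locF a′ = locF a`
  (`e · 2δ_L` is real because `ē = −e` and `δ̄_L = −δ_L`, and non-zero because `e ≠ 0 ≠ δ_L`).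
* Since `2 · imagUnit L ≠ 0` (characteristic zero, ★ `imagUnit_ne_zero`), `a′ · (2δ_L)⁻¹ = e · (2δ_L) · (2δ_L)⁻¹ = e`
  (`mul_inv_cancel_right₀`), which is `Φ`-admissible by hypothesis; `algebraMap L⁺ L` is the subtype inclusion.
* §1 `exists_unit_locF_eq_and_coe_mul_inv_eq` — the POINTED form (keeps the admissible `e` in view: `a′ · (2δ_L)⁻¹ = e`), reusable by
  the closer #4 `sig_K2E2AdmRepresentative` and by any consumer that needs the representative's `e` explicitly.
* §2 **`admUnitOfAdmissibleElement`** — `sig_K2E2AdmUnitOfAdmissibleElement` TOKEN FOR TOKEN (statement bytes pasted from the socket).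
No hypothesis is idle: the conclusion quantifies over the given `Φ` and `a`, and without the `∃ e` hypothesis it fails (e.g. `Φ = Hom(L, ℂ)`
admits no admissible element at all: `Im τ′(e) < 0` and `Im τ̄′(e) = −Im τ′(e) < 0` cannot both hold).

HONEST LABEL: HC_CM is proved only modulo the 7 printed citations (2 remaining named inputs: hLiu418 = stmt-HodgeConjecture-24832,
h413 = stmt-HodgeConjecture-24833) until rung 0 closes; this file is a `--supports stmt-HodgeConjecture-24833` helper (scaffold of the
K2_E2 road, unit ADM-REP, consumed BY NAME by the closer #4 `K2E2AdmRepresentative`) and retires nothing by itself.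

## References
* [Liu2021] Y. Liu, *Fourier–Jacobi cycles and arithmetic relative trace formula*, Camb. J. Math. 9 (2021) = arXiv:2102.11518,
  Def. 4.11 (l. 2090–2096), Def. 4.12 (l. 2102–2108), Rem. 4.14.
-/

set_option autoImplicit false
-- the mandated namespace repeats the single-problem summit's segment (`HodgeConjecture.HodgeConjecture`)
set_option linter.dupNamespace false

noncomputable section

open NumberField IsDedekindDomain

namespace Summit.HodgeConjecture.HodgeConjecture.Cruxes.H413.K2E2AdmUnitOfAdmissibleElement

open Literature.NumberTheory.Automorphic Literature.NumberTheory.Automorphic.UnitaryGroup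
open Literature.NumberTheory.Automorphic.Liu2021
open Literature.NumberTheory.Automorphic.Liu2021.Def411WeilCarriers
open Literature.NumberTheory.GelbartRogawski1991 Literature.NumberTheory.GelbartRogawski1991.UnitaryDualPair
open Literature.AlgebraicGeometry.Liu2021 (IsAdmissibleElement)
open Summit.HodgeConjecture.HodgeConjecture.Cruxes.H413

/-! ## §1  The pointed form: the unit representative `a′` with `a′ · (2δ_L)⁻¹ = e` -/

/-- **The admissible unit representative, pointed form.**  If `e ∈ L` is `Φ`-admissible with `epsOf (2δ_L)⁻¹ e = locF a`, then there
is a unit `a′ ∈ (L⁺)ˣ` with `locF a′ = locF a` and `a′ · (2 · imagUnit L)⁻¹ = e` (so in particular `a′ · (2δ_L)⁻¹` is `Φ`-admissible):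
`a′ := e · 2δ_L` (★ `exists_admissibleUnit_of_hadm`), and `2δ_L ≠ 0` cancels. [cite: Liu2021, Def. 4.12 (l. 2102–2108)] -/
theorem exists_unit_locF_eq_and_coe_mul_inv_eq (L : Type) [Field L] [NumberField L] [IsCMField L] (Φ : Set (L →+* ℂ))
    (a : (↥(maximalRealSubfield L))ˣ) (e : L) (he : IsAdmissibleElement L Φ e)
    (heps : epsOf (↥(maximalRealSubfield L)) (imagUnitSq L) L (2 * imagUnit L)⁻¹ e =
      locF (↥(maximalRealSubfield L)) (imagUnitSq L) a) :
    ∃ a' : (↥(maximalRealSubfield L))ˣ,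
      locF (↥(maximalRealSubfield L)) (imagUnitSq L) a' = locF (↥(maximalRealSubfield L)) (imagUnitSq L) a ∧
        algebraMap (↥(maximalRealSubfield L)) L a' * (2 * imagUnit L)⁻¹ = e := by
  -- ★ `exists_admissibleUnit_of_hadm` only returns SOME admissible `e'` with `(a' : L) = e' * (2 * imagUnit L)`; for the pointed
  -- form we build the representative of `e` itself, exactly as ★ does (same two ★ `AdmissibleLine` lemmas).
  refine ⟨Units.mk0 ⟨e * (2 * imagUnit L), AdmissibleLine.lineScalar_mem (complexConj_imagUnit L) he.2.1⟩
    (AdmissibleLine.lineScalar_subtype_ne_zero (complexConj_imagUnit L) (imagUnit_ne_zero L) he.2.1 he.1), ?_, ?_⟩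
  · rw [← AdmissibleLine.epsOf_eq_locF_mk0 (imagUnitSq L) (complexConj_imagUnit L) (imagUnit_ne_zero L) he.2.1 he.1]
    exact heps
  · have h2 : (2 * imagUnit L) ≠ 0 := mul_ne_zero two_ne_zero (imagUnit_ne_zero L)
    show e * (2 * imagUnit L) * (2 * imagUnit L)⁻¹ = e
    rw [mul_inv_cancel_right₀ h2]

/-! ## §2  The socket, token for token -/

/-- **PAYMENT OF `sig_K2E2AdmUnitOfAdmissibleElement`** (socket #3 of unit ADM-REP of the K2_E2 road,
`Cruxes/H413/Lines/K2_E2_ThetaExhaustionByRigidity_AdmRep.lean`, TOKEN FOR TOKEN).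
**From an admissible element to an admissible unit representative of the same collection.**  If some `e ∈ L` is `Φ`-admissible
([Liu2021, Def. 4.12]) with `epsOf (2δ_L)⁻¹ e = locF a`, then `a′ := e · 2δ_L ∈ (L⁺)ˣ` (★ `exists_admissibleUnit_of_hadm`: real,
non-zero, `locF a′ = locF a`) and `a′ · (2δ_L)⁻¹ = e` is `Φ`-admissible (`(a′ : L) = e · (2 · imagUnit L)`, `mul_inv_cancel_right₀`,
`2 · imagUnit L ≠ 0`). [cite: Liu2021, Def. 4.12 (l. 2102–2108)] -/
theorem admUnitOfAdmissibleElement :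
    ∀ (L : Type) [Field L] [NumberField L] [IsCMField L] (Φ : Set (L →+* ℂ)) (a : (↥(maximalRealSubfield L))ˣ),
      (∃ e : L, IsAdmissibleElement L Φ e ∧
        epsOf (↥(maximalRealSubfield L)) (imagUnitSq L) L (2 * imagUnit L)⁻¹ e = locF (↥(maximalRealSubfield L)) (imagUnitSq L) a) →
      ∃ a' : (↥(maximalRealSubfield L))ˣ,
        locF (↥(maximalRealSubfield L)) (imagUnitSq L) a' = locF (↥(maximalRealSubfield L)) (imagUnitSq L) a ∧
        IsAdmissibleElement L Φ (algebraMap (↥(maximalRealSubfield L)) L a' * (2 * imagUnit L)⁻¹) := by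
  intro L _ _ _ Φ a hadm
  obtain ⟨e, he, a', ha', hloc⟩ := F0P2sThetaOccursInLineTransport.exists_admissibleUnit_of_hadm L Φ a hadm
  refine ⟨a', hloc, ?_⟩
  have h2 : (2 * imagUnit L) ≠ 0 := mul_ne_zero two_ne_zero (imagUnit_ne_zero L)
  have hval : algebraMap (↥(maximalRealSubfield L)) L a' = e * (2 * imagUnit L) := ha'
  rw [hval, mul_inv_cancel_right₀ h2]
  exact he

end Summit.HodgeConjecture.HodgeConjecture.Cruxes.H413.K2E2AdmUnitOfAdmissibleElement

end
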